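import Literature.NumberTheory.Automorphic.Liu2021.AppendixC.OmegaHomBlockAlgebra
import Literature.RingTheory.CentralSimple.PositiveInvolutionStableSubalgebra
import HarnessLib

/-!
# [Liu 2021, p. 133 (D.3)] CONVERSE of DH2b: a semisimple Hecke image `heckeImage K ⊆ End⁰(A_K)` makes `H¹_ét(A_K)` (and `ℚ̄_ℓ ⊗ H¹_ét(A_K)`)
# a SEMISIMPLE Hecke module — in particular a positive anti-involution of `End⁰(A_K)` stabilising the Hecke image does ([Mumford §21 Thm. 1])

Topic `NumberTheory/Automorphic/Liu2021/AppendixC`; namespace `Literature.NumberTheory.Automorphic.Liu2021.AppendixC.Sec42Data.HeckeTranslates`.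
THEOREMS ONLY (no definition, no named fact, no instance, no `sorry`).

Print, [Liu2021] p. 133: the Hecke algebra `C_c^∞(K\G(𝔸^∞)/K, ℚ)` acts on `A_K` through a finite-dimensional `ℚ`-algebra (★ `heckeImage K`,
«the homomorphism `C_c^∞(K\G(𝔸^∞)/K, ℚ) → End(A_K)_ℚ`», FJcycle.tex l. 5463) and the level-`K` cohomology is a direct sum of isotypic pieces
«of `C_c^∞(K\G(𝔸^∞)/K, ℚ)`-modules» (D.3).  ★ DH2b (`HeckeImageSemisimple`, `EtaleH1LevelSemisimple`) derives «`heckeImage K` is a semisimple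
ring» FROM the semisimplicity of the Hecke module `H¹_ét(A_K)`.  This file proves the CONVERSE direction, which is pure algebra — a module over
a semisimple ring is semisimple — once the realisation `ℚ_ℓ ⊗_ℚ (heckeImage K)ᵐᵒᵖ ↠ ℚ_ℓ[ᵗV_ℓ^ℚ(heckeEnd K g) : g]` is written down (§1; the
`ℚ̄_ℓ ⊗` form is ★ `exists_algHom_tensor_mulOpposite_heckeImage_surjective`), so that the two level-`K` sentences

  «`heckeImage K` is a semisimple ring»   and   «`H¹_ét(A_K)` is a semisimple module over `ℚ_ℓ[ᵗV_ℓ^ℚ(heckeEnd K g) : g]`»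

are EQUIVALENT (`isSemisimpleRing_heckeImage_iff_isSemisimpleModule_etaleH1`).  The point for the cell: the first sentence follows in ONE
line from a positive anti-involution of `End⁰(A_K)` stabilising `heckeImage K` ([MumfordAV1970] §21 Thm. 1 for the subalgebra, ★
`IsPositiveAntiInvolution.isSemisimpleRing_subalgebra`) — e.g. the Rosati involution of a polarisation ([MumfordAV1970] §20–§21,
[Lange2023AbelianVarietiesComplex] §2.4.1 Thm. 2.4.9: it is positive) for which the Hecke correspondences have adjoints among Hecke
correspondences — so that, granted such an involution at every small level, NO separate semisimplicity citation is needed at level `K` (§3).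

* §1 `exists_algHom_padicTensor_mulOpposite_heckeImage_surjective` — `c ⊗ h ↦ c · ᵗV_ℓ^ℚ(h)` is a surjective `ℚ_ℓ`-algebra map
  `ℚ_ℓ ⊗_ℚ (heckeImage K)ᵐᵒᵖ ↠ ℚ_ℓ[ᵗV_ℓ^ℚ(heckeEnd K g) : g] ⊆ End_{ℚ_ℓ}(H¹_ét(A_K))`.
* §2 from `IsSemisimpleRing (heckeImage K)`: `isSemisimpleRing_adjoin_dualMap_of_isSemisimpleRing_heckeImage` (the operator algebra on `H¹`),
  **`isSemisimpleModule_etaleH1_of_isSemisimpleRing_heckeImage`** (the cell's level-`K` «S1c» text), the homology-side twins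
  (`…adjoin_rationalTateAction…`, `…tateModule…`, through ★ `isSemisimpleRing_adjoin_rationalTateAction_of_isSemisimpleModule_etaleH1`), the
  iff with ★ DH2b, and the `ℚ̄_ℓ ⊗` forms `isSemisimpleRing_adjoin_baseChange_of_isSemisimpleRing_heckeImage` /
  `isSemisimpleModule_baseChange_etaleH1_of_isSemisimpleRing_heckeImage` (= ★ `isSemisimpleRing_adjoin_baseChange` without the `G`-level binder `σ`).
* §3 from a positive anti-involution `τ` of `End⁰(A_K)` with `τ(heckeImage K) ⊆ heckeImage K`: `isSemisimpleRing_heckeImage_of_isPositiveAntiInvolution`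
  and the compositions with §2 (`…_of_isPositiveAntiInvolution`, `…_of_exists_isPositiveAntiInvolution`).

DICTIONARY LINE (cell `hodgecm-mathlib`, crux `HLiu418` = stmt-HodgeConjecture-24832, d6 S2′): the HOME socket `SocketRos T hD` («`∀ K, ∃ τ` positive
anti-involution of `End⁰(A_K)` stabilising `heckeImage K`») discharges the level-`K` S1c sentence `S1cShape` and the semisimplicity inputs of ★
`OmegaHomBlockAlgebra` / ★ `OmegaHomBlockFieldCharacter` §1 that enter there through `σ`.  EVERY statement here is LEVEL-`K` ∕ RING-LEVEL: nothing in
this file produces the `G`-level binder `σ.IsSemisimpleRepresentation` on `ℚ̄_ℓ ⊗ H¹_ét(A_∞)`, and the `G`-level extension step (★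
`exists_mem_omegaHom_extending`) is NOT touched.  Count-neutral (`--supports` stmt-HodgeConjecture-24832); HC_CM is proved only modulo the 7 printed
citations until rung 0 closes.

## References
* [Liu2021] Y. Liu, *Fourier–Jacobi cycles and arithmetic relative trace formula*, Camb. J. Math. 9 (2021): p. 133 (before and at (D.3), FJcycle.tex
  l. 5463–5470: «a homomorphism `C_c^∞(K\G(𝔸^∞)/K, ℚ) → End(A_K)_ℚ` … of `C_c^∞(K\G(𝔸^∞)/K, ℚ)`-modules»).
* [MumfordAV1970] D. Mumford, *Abelian Varieties* (1970), §19 Thm. 3 and Cor. 1–2; §21 Thm. 1.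
* [Lange2023AbelianVarietiesComplex] H. Lange, *Abelian Varieties over the Complex Numbers* (2023), §2.4.1 Thm. 2.4.9 (positivity of the Rosati
  involution) and §2.6.2 (anti-involutions).
* [Lam2001FirstCourse] T. Y. Lam, *A First Course in Noncommutative Rings*, 2nd ed. (2001), §2 Theorem and Definition (2.5) («all left `R`-modules
  are semisimple» ⟺ `R` semisimple), §9 Prop. (9.11).
* [Pierce1982] R. S. Pierce, *Associative Algebras* (1982), §10.6 Corollary (p. 189), §10.7 Corollary b (p. 191).
-/

set_option autoImplicit false

noncomputable section

open CategoryTheory NumberField Function MulAction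
open scoped TensorProduct

namespace Literature.NumberTheory.Automorphic.Liu2021.AppendixC

open Literature.AlgebraicGeometry.Motives (AbelianVariety)
open Literature.AlgebraicGeometry.Motives.AbelianVariety (rationalTateModuleMap endAlgebra rationalTateAction rationalTateAction_algebraMap)

variable {F E : Type} [Field F] [NumberField F] [IsTotallyReal F] [Field E] [NumberField E] [Algebra F E]
  [IsTotallyComplex E] [Algebra.IsQuadraticExtension F E]
variable {P5 : PropC5Data F E} {isotropicAt : ℕ → Prop}

namespace Sec42Data.HeckeTranslates

variable {C : Sec42Data P5 isotropicAt} (T : C.HeckeTranslates) (ℓ : ℕ) [Fact ℓ.Prime] (K : C5.SmallLevel C.S.K₀)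

/-! ## §1 The realisation `ℚ_ℓ ⊗_ℚ (heckeImage K)ᵐᵒᵖ ↠ ℚ_ℓ[ᵗV_ℓ^ℚ(heckeEnd K g) : g]` -/

/-- `ᵗV_ℓ^ℚ(x y) = ᵗV_ℓ^ℚ(y) ∘ ᵗV_ℓ^ℚ(x)` (contravariance of `H¹`). [cite: MumfordAV1970, §19 Thm. 3] -/
theorem dualMap_rationalTateAction_mul (x y : (C.A K).endAlgebra) :
    (rationalTateAction (C.A K) ℓ (x * y)).dualMap =
      (rationalTateAction (C.A K) ℓ y).dualMap * (rationalTateAction (C.A K) ℓ x).dualMap := by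
  rw [map_mul, Module.End.mul_eq_comp, ← LinearMap.dualMap_comp_dualMap, ← Module.End.mul_eq_comp]

/-- `ᵗV_ℓ^ℚ(x + y) = ᵗV_ℓ^ℚ(x) + ᵗV_ℓ^ℚ(y)`. [cite: MumfordAV1970, §19 Thm. 3] -/
theorem dualMap_rationalTateAction_add (x y : (C.A K).endAlgebra) :
    (rationalTateAction (C.A K) ℓ (x + y)).dualMap =
      (rationalTateAction (C.A K) ℓ x).dualMap + (rationalTateAction (C.A K) ℓ y).dualMap := by
  rw [map_add]
  ext φ v
  simp [LinearMap.dualMap_apply]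

/-- `ᵗV_ℓ^ℚ(1) = 1`. [cite: MumfordAV1970, §19 Thm. 3] -/
theorem dualMap_rationalTateAction_one :
    (rationalTateAction (C.A K) ℓ (1 : (C.A K).endAlgebra)).dualMap = (1 : Module.End ℚ_[ℓ] (C.etaleH1 ℓ K)) := by
  rw [map_one, Module.End.one_eq_id, Module.End.one_eq_id]
  exact LinearMap.dualMap_id

/-- `ᵗV_ℓ^ℚ(0) = 0`. [cite: MumfordAV1970, §19 Thm. 3] -/
theorem dualMap_rationalTateAction_zero :
    (rationalTateAction (C.A K) ℓ (0 : (C.A K).endAlgebra)).dualMap = (0 : Module.End ℚ_[ℓ] (C.etaleH1 ℓ K)) := by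
  rw [map_zero]
  ext φ v
  simp [LinearMap.dualMap_apply]

/-- Scalars: `ᵗV_ℓ^ℚ(q · 1) = q · 1` for `q ∈ ℚ`. [cite: MumfordAV1970, §19 Thm. 3] -/
theorem dualMap_rationalTateAction_algebraMap (q : ℚ) :
    (rationalTateAction (C.A K) ℓ (algebraMap ℚ (C.A K).endAlgebra q)).dualMap =
      algebraMap ℚ_[ℓ] (Module.End ℚ_[ℓ] (C.etaleH1 ℓ K)) (algebraMap ℚ ℚ_[ℓ] q) := by
  rw [rationalTateAction_algebraMap]
  ext φ v
  simp [LinearMap.dualMap_apply, Algebra.algebraMap_eq_smul_one]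

/-- **The realisation of `ℚ_ℓ ⊗_ℚ (heckeImage K)ᵐᵒᵖ` ONTO `ℚ_ℓ[ᵗV_ℓ^ℚ(heckeEnd K g) : g] ⊆ End_{ℚ_ℓ}(H¹_ét(A_K))`.**  The map `h ↦ ᵗV_ℓ^ℚ(h)` is a
`ℚ`-algebra ANTI-homomorphism out of `heckeImage K` (`H¹` is contravariant), i.e. an algebra homomorphism out of the opposite algebra, with values in
the operator algebra (★ `dualMap_rationalTateAction_mem_adjoin_of_mem`); its `ℚ_ℓ`-linear extension `c ⊗ h ↦ c · ᵗV_ℓ^ℚ(h)` is a `ℚ_ℓ`-algebra map ONTO it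
(the generators `ᵗV_ℓ^ℚ(heckeEnd K g)` are values).  (`ℚ_ℓ`-level twin of ★ `exists_algHom_tensor_mulOpposite_heckeImage_surjective`.)
[cite: Liu2021, p. 133 (before (D.3), FJcycle.tex l. 5463)] [cite: MumfordAV1970, §19 Thm. 3] -/
theorem exists_algHom_padicTensor_mulOpposite_heckeImage_surjective (hD : T.IsogenyDescent) :
    ∃ Ψ : ℚ_[ℓ] ⊗[ℚ] (↥(T.heckeImage hD K))ᵐᵒᵖ →ₐ[ℚ_[ℓ]]
        ↥(Algebra.adjoin ℚ_[ℓ] (Set.range fun g : C.G => (rationalTateAction (C.A K) ℓ (T.heckeEnd hD K g)).dualMap)),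
      Function.Surjective Ψ ∧
      ∀ x : ↥(T.heckeImage hD K),
        ((Ψ ((1 : ℚ_[ℓ]) ⊗ₜ[ℚ] MulOpposite.op x) :
            ↥(Algebra.adjoin ℚ_[ℓ] (Set.range fun g : C.G => (rationalTateAction (C.A K) ℓ (T.heckeEnd hD K g)).dualMap))) :
            Module.End ℚ_[ℓ] (C.etaleH1 ℓ K)) =
          (rationalTateAction (C.A K) ℓ (x : (C.A K).endAlgebra)).dualMap := by
  classical
  set S : Set (Module.End ℚ_[ℓ] (C.etaleH1 ℓ K)) :=
    Set.range fun g : C.G => (rationalTateAction (C.A K) ℓ (T.heckeEnd hD K g)).dualMap with hS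
  -- OPAQUE abbreviation `op x = ᵗV_ℓ^ℚ x`
  obtain ⟨op, hop⟩ : ∃ op : (C.A K).endAlgebra → Module.End ℚ_[ℓ] (C.etaleH1 ℓ K),
      op = fun x => (rationalTateAction (C.A K) ℓ x).dualMap := ⟨_, rfl⟩
  have hop' : ∀ x, op x = (rationalTateAction (C.A K) ℓ x).dualMap := fun x => by rw [hop]
  have op_mul : ∀ x y, op (x * y) = op y * op x := fun x y => by
    rw [hop', hop', hop']
    exact dualMap_rationalTateAction_mul ℓ K x y
  have op_add : ∀ x y, op (x + y) = op x + op y := fun x y => by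
    rw [hop', hop', hop']
    exact dualMap_rationalTateAction_add ℓ K x y
  have op_one : op 1 = 1 := by rw [hop']; exact dualMap_rationalTateAction_one ℓ K
  have op_zero : op 0 = 0 := by rw [hop']; exact dualMap_rationalTateAction_zero ℓ K
  have op_algebraMap : ∀ q : ℚ, op (algebraMap ℚ (C.A K).endAlgebra q) =
      algebraMap ℚ_[ℓ] (Module.End ℚ_[ℓ] (C.etaleH1 ℓ K)) (algebraMap ℚ ℚ_[ℓ] q) := fun q => by
    rw [hop']
    exact dualMap_rationalTateAction_algebraMap ℓ K q
  have op_mem : ∀ x ∈ T.heckeImage hD K, op x ∈ Algebra.adjoin ℚ_[ℓ] S := by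
    intro x hx
    rw [hop', hS]
    exact T.dualMap_rationalTateAction_mem_adjoin_of_mem ℓ hD K hx
  -- the `ℚ`-algebra structure on the operator algebra through `ℚ_ℓ` (local)
  letI algQ : Algebra ℚ ↥(Algebra.adjoin ℚ_[ℓ] S) :=
    ((algebraMap ℚ_[ℓ] ↥(Algebra.adjoin ℚ_[ℓ] S)).comp (algebraMap ℚ ℚ_[ℓ])).toAlgebra' fun q x => Algebra.commutes (algebraMap ℚ ℚ_[ℓ] q) x
  haveI : IsScalarTower ℚ ℚ_[ℓ] ↥(Algebra.adjoin ℚ_[ℓ] S) := IsScalarTower.of_algebraMap_eq fun _ => rfl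
  -- `Ψ₀ : (heckeImage K)ᵐᵒᵖ →ₐ[ℚ] ℚ_ℓ[S]`, `op h ↦ ᵗV_ℓ^ℚ(h)`
  let Ψ₀ : (↥(T.heckeImage hD K))ᵐᵒᵖ →ₐ[ℚ] ↥(Algebra.adjoin ℚ_[ℓ] S) :=
    { toFun := fun x => ⟨op ((MulOpposite.unop x : ↥(T.heckeImage hD K)) : (C.A K).endAlgebra), op_mem _ (MulOpposite.unop x).2⟩
      map_one' := Subtype.ext (by
        change op (((MulOpposite.unop (1 : (↥(T.heckeImage hD K))ᵐᵒᵖ)) : ↥(T.heckeImage hD K)) : (C.A K).endAlgebra) = _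
        rw [MulOpposite.unop_one, OneMemClass.coe_one, op_one]
        rfl)
      map_mul' := fun x y => Subtype.ext (by
        change op (((MulOpposite.unop (x * y)) : ↥(T.heckeImage hD K)) : (C.A K).endAlgebra) =
          op ((MulOpposite.unop x : ↥(T.heckeImage hD K)) : (C.A K).endAlgebra) * op ((MulOpposite.unop y : ↥(T.heckeImage hD K)) : (C.A K).endAlgebra)
        rw [MulOpposite.unop_mul, Subalgebra.coe_mul, op_mul])
      map_zero' := Subtype.ext (by
        change op (((MulOpposite.unop (0 : (↥(T.heckeImage hD K))ᵐᵒᵖ)) : ↥(T.heckeImage hD K)) : (C.A K).endAlgebra) = _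
        rw [MulOpposite.unop_zero, ZeroMemClass.coe_zero, op_zero]
        rfl)
      map_add' := fun x y => Subtype.ext (by
        change op (((MulOpposite.unop (x + y)) : ↥(T.heckeImage hD K)) : (C.A K).endAlgebra) =
          op ((MulOpposite.unop x : ↥(T.heckeImage hD K)) : (C.A K).endAlgebra) + op ((MulOpposite.unop y : ↥(T.heckeImage hD K)) : (C.A K).endAlgebra)
        rw [MulOpposite.unop_add, AddMemClass.coe_add, op_add])
      commutes' := fun q => Subtype.ext (by
        change op (((MulOpposite.unop (algebraMap ℚ (↥(T.heckeImage hD K))ᵐᵒᵖ q)) : ↥(T.heckeImage hD K)) : (C.A K).endAlgebra) =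
          ((algebraMap ℚ_[ℓ] ↥(Algebra.adjoin ℚ_[ℓ] S) (algebraMap ℚ ℚ_[ℓ] q) : ↥(Algebra.adjoin ℚ_[ℓ] S)) : Module.End ℚ_[ℓ] (C.etaleH1 ℓ K))
        rw [MulOpposite.algebraMap_apply, MulOpposite.unop_op, Subalgebra.coe_algebraMap, op_algebraMap, Subalgebra.coe_algebraMap]) }
  have hΨ₀ : ∀ x : ↥(T.heckeImage hD K), ((Ψ₀ (MulOpposite.op x) : ↥(Algebra.adjoin ℚ_[ℓ] S)) : Module.End ℚ_[ℓ] (C.etaleH1 ℓ K)) =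
      op (x : (C.A K).endAlgebra) := fun _ => rfl
  -- `Ψ = ℚ_ℓ ⊗ Ψ₀`
  let Ψ : ℚ_[ℓ] ⊗[ℚ] (↥(T.heckeImage hD K))ᵐᵒᵖ →ₐ[ℚ_[ℓ]] ↥(Algebra.adjoin ℚ_[ℓ] S) :=
    Algebra.TensorProduct.lift (Algebra.ofId ℚ_[ℓ] _) Ψ₀ fun c y => Algebra.commutes c (Ψ₀ y)
  have hΨ : ∀ (c : ℚ_[ℓ]) (y : (↥(T.heckeImage hD K))ᵐᵒᵖ), Ψ (c ⊗ₜ[ℚ] y) = c • Ψ₀ y := fun c y => by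
    change Algebra.TensorProduct.lift _ _ _ (c ⊗ₜ[ℚ] y) = _
    rw [Algebra.TensorProduct.lift_tmul, Algebra.ofId_apply, Algebra.smul_def]
  refine ⟨Ψ, ?_, fun x => ?_⟩
  · -- surjective: the range is a subalgebra containing the generators
    rintro ⟨y, hy⟩
    induction hy using Algebra.adjoin_induction with
    | mem s hs =>
      rw [hS] at hs
      obtain ⟨g, rfl⟩ := hs
      refine ⟨(1 : ℚ_[ℓ]) ⊗ₜ[ℚ] MulOpposite.op ⟨T.heckeEnd hD K g, T.heckeEnd_mem_heckeImage hD K g⟩, Subtype.ext ?_⟩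
      rw [hΨ, one_smul, hΨ₀, hop']
    | algebraMap c => exact ⟨algebraMap ℚ_[ℓ] _ c, by rw [AlgHom.commutes]; rfl⟩
    | add x y _ _ hx hy =>
      obtain ⟨s, hs⟩ := hx
      obtain ⟨t, ht⟩ := hy
      exact ⟨s + t, by rw [map_add, hs, ht]; rfl⟩
    | mul x y _ _ hx hy =>
      obtain ⟨s, hs⟩ := hx
      obtain ⟨t, ht⟩ := hy
      exact ⟨s * t, by rw [map_mul, hs, ht]; rfl⟩
  · rw [hΨ, one_smul, hΨ₀, hop']

/-! ## §2 A semisimple Hecke image makes the level-`K` Hecke modules semisimple -/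

/-- **The operator algebra `ℚ_ℓ[ᵗV_ℓ^ℚ(heckeEnd K g) : g] ⊆ End(H¹_ét(A_K))` is a semisimple ring when `heckeImage K` is**: it is a quotient (§1) of
`ℚ_ℓ ⊗_ℚ (heckeImage K)ᵐᵒᵖ`, which is semisimple (opposite of a semisimple ring; base change of a finite-dimensional semisimple `ℚ`-algebra along
`ℚ → ℚ_ℓ`, ★ `isSemisimpleRing_baseChange`), and quotients of semisimple rings are semisimple. [cite: Pierce1982, §10.6 Corollary (p. 189) and §10.7 Corollary b (p. 191)]
[cite: Liu2021, p. 133 (before and at (D.3))] -/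
theorem isSemisimpleRing_adjoin_dualMap_of_isSemisimpleRing_heckeImage (hD : T.IsogenyDescent)
    (hH : IsSemisimpleRing ↥(T.heckeImage hD K)) :
    IsSemisimpleRing ↥(Algebra.adjoin ℚ_[ℓ] (Set.range fun g : C.G => (rationalTateAction (C.A K) ℓ (T.heckeEnd hD K g)).dualMap)) := by
  obtain ⟨Ψ, hΨs, -⟩ := T.exists_algHom_padicTensor_mulOpposite_heckeImage_surjective ℓ K hD
  haveI : IsSemisimpleRing ↥(T.heckeImage hD K) := hH
  haveI : Module.Finite ℚ ↥(T.heckeImage hD K) := T.module_finite_heckeImage hD K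
  haveI : IsSemisimpleRing (ℚ_[ℓ] ⊗[ℚ] (↥(T.heckeImage hD K))ᵐᵒᵖ) :=
    Literature.RingTheory.SimpleModule.isSemisimpleRing_baseChange ℚ (↥(T.heckeImage hD K))ᵐᵒᵖ ℚ_[ℓ]
  exact RingHom.isSemisimpleRing_of_surjective Ψ.toRingHom hΨs

/-- **`H¹_ét(A_K)` IS A SEMISIMPLE HECKE MODULE when `heckeImage K` is a semisimple ring** — the converse of ★ DH2b
`isSemisimpleRing_heckeImage_of_isSemisimpleModule`, in the same currency (a module over a semisimple ring is semisimple).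
[cite: Lam2001FirstCourse, §2 Theorem and Definition (2.5)] [cite: Liu2021, p. 133 (D.3)] -/
theorem isSemisimpleModule_etaleH1_of_isSemisimpleRing_heckeImage (hD : T.IsogenyDescent)
    (hH : IsSemisimpleRing ↥(T.heckeImage hD K)) :
    IsSemisimpleModule
      ↥(Algebra.adjoin ℚ_[ℓ] (Set.range fun g : C.G => (rationalTateAction (C.A K) ℓ (T.heckeEnd hD K g)).dualMap))
      (C.etaleH1 ℓ K) := by
  haveI := T.isSemisimpleRing_adjoin_dualMap_of_isSemisimpleRing_heckeImage ℓ K hD hH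
  infer_instance

/-- **The two level-`K` sentences are equivalent**: `heckeImage K` is a semisimple ring iff `H¹_ét(A_K)` is a semisimple module over
`ℚ_ℓ[ᵗV_ℓ^ℚ(heckeEnd K g) : g]` (→ this file; ← ★ DH2b). [cite: Liu2021, p. 133 (before and at (D.3))] [cite: Lam2001FirstCourse, §9 Prop. (9.11) p. 146] -/
theorem isSemisimpleRing_heckeImage_iff_isSemisimpleModule_etaleH1 (hD : T.IsogenyDescent) :
    IsSemisimpleRing ↥(T.heckeImage hD K) ↔
      IsSemisimpleModule
        ↥(Algebra.adjoin ℚ_[ℓ] (Set.range fun g : C.G => (rationalTateAction (C.A K) ℓ (T.heckeEnd hD K g)).dualMap))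
        (C.etaleH1 ℓ K) :=
  ⟨T.isSemisimpleModule_etaleH1_of_isSemisimpleRing_heckeImage ℓ K hD, T.isSemisimpleRing_heckeImage_of_isSemisimpleModule ℓ hD K⟩

/-- Homology side: the operator algebra `ℚ_ℓ[V_ℓ^ℚ(heckeEnd K g) : g] ⊆ End(V_ℓ A_K)` is a semisimple ring when `heckeImage K` is
(§2 + the transpose, ★ `isSemisimpleRing_adjoin_rationalTateAction_of_isSemisimpleModule_etaleH1`).
[cite: Liu2021, p. 133 (before and at (D.3))] [cite: Lam2001FirstCourse, §9 Prop. (9.11) p. 146] -/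
theorem isSemisimpleRing_adjoin_rationalTateAction_of_isSemisimpleRing_heckeImage (hD : T.IsogenyDescent)
    (hH : IsSemisimpleRing ↥(T.heckeImage hD K)) :
    IsSemisimpleRing ↥(Algebra.adjoin ℚ_[ℓ] (Set.range fun g : C.G => rationalTateAction (C.A K) ℓ (T.heckeEnd hD K g))) :=
  T.isSemisimpleRing_adjoin_rationalTateAction_of_isSemisimpleModule_etaleH1 ℓ hD K
    (T.isSemisimpleModule_etaleH1_of_isSemisimpleRing_heckeImage ℓ K hD hH)

/-- Homology side: `V_ℓ A_K` is a semisimple module over `ℚ_ℓ[V_ℓ^ℚ(heckeEnd K g) : g]` when `heckeImage K` is a semisimple ring.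
[cite: Lam2001FirstCourse, §2 Theorem and Definition (2.5)] [cite: Liu2021, p. 133 (D.3)] -/
theorem isSemisimpleModule_tateModule_of_isSemisimpleRing_heckeImage (hD : T.IsogenyDescent)
    (hH : IsSemisimpleRing ↥(T.heckeImage hD K)) :
    IsSemisimpleModule
      ↥(Algebra.adjoin ℚ_[ℓ] (Set.range fun g : C.G => rationalTateAction (C.A K) ℓ (T.heckeEnd hD K g)))
      ((C.A K).rationalTateModule ℓ) := by
  haveI := T.isSemisimpleRing_adjoin_rationalTateAction_of_isSemisimpleRing_heckeImage ℓ K hD hH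
  infer_instance

/-- **`ℚ̄_ℓ ⊗` form — the operator algebra `𝒜 = ℚ̄_ℓ[ᵗV_ℓ^ℚ(heckeEnd K g) ⊗ 1 : g]` is a semisimple ring when `heckeImage K` is**: `𝒜` is a
quotient of the semisimple `ℚ̄_ℓ ⊗_ℚ (heckeImage K)ᵐᵒᵖ` (★ `exists_algHom_tensor_mulOpposite_heckeImage_surjective`).  This is ★
`isSemisimpleRing_adjoin_baseChange` with the `G`-level binder `σ` replaced by the level-`K` ring hypothesis.
[cite: Pierce1982, §10.6 Corollary (p. 189) and §10.7 Corollary b (p. 191)] [cite: Liu2021, p. 133 (D.3)] -/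
theorem isSemisimpleRing_adjoin_baseChange_of_isSemisimpleRing_heckeImage (hD : T.IsogenyDescent)
    (hH : IsSemisimpleRing ↥(T.heckeImage hD K))
    (S : Set (Module.End (AlgebraicClosure ℚ_[ℓ]) (AlgebraicClosure ℚ_[ℓ] ⊗[ℚ_[ℓ]] C.etaleH1 ℓ K)))
    (hS : S = Set.range fun g : C.G => ((rationalTateAction (C.A K) ℓ (T.heckeEnd hD K g)).dualMap).baseChange (AlgebraicClosure ℚ_[ℓ])) :
    IsSemisimpleRing ↥(Algebra.adjoin (AlgebraicClosure ℚ_[ℓ]) S) := by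
  obtain ⟨Φ, hΦs, -⟩ := T.exists_algHom_tensor_mulOpposite_heckeImage_surjective K hD S hS
  haveI : IsSemisimpleRing ↥(T.heckeImage hD K) := hH
  haveI : Module.Finite ℚ ↥(T.heckeImage hD K) := T.module_finite_heckeImage hD K
  haveI : IsSemisimpleRing (AlgebraicClosure ℚ_[ℓ] ⊗[ℚ] (↥(T.heckeImage hD K))ᵐᵒᵖ) :=
    Literature.RingTheory.SimpleModule.isSemisimpleRing_baseChange ℚ (↥(T.heckeImage hD K))ᵐᵒᵖ (AlgebraicClosure ℚ_[ℓ])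
  exact RingHom.isSemisimpleRing_of_surjective Φ.toRingHom hΦs

/-- **`ℚ̄_ℓ ⊗ H¹_ét(A_K)` is a semisimple `𝒜`-module when `heckeImage K` is a semisimple ring** (`𝒜` semisimple, previous theorem).
[cite: Lam2001FirstCourse, §2 Theorem and Definition (2.5)] [cite: Liu2021, p. 133 (D.3)] -/
theorem isSemisimpleModule_baseChange_etaleH1_of_isSemisimpleRing_heckeImage (hD : T.IsogenyDescent)
    (hH : IsSemisimpleRing ↥(T.heckeImage hD K))
    (S : Set (Module.End (AlgebraicClosure ℚ_[ℓ]) (AlgebraicClosure ℚ_[ℓ] ⊗[ℚ_[ℓ]] C.etaleH1 ℓ K)))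
    (hS : S = Set.range fun g : C.G => ((rationalTateAction (C.A K) ℓ (T.heckeEnd hD K g)).dualMap).baseChange (AlgebraicClosure ℚ_[ℓ])) :
    IsSemisimpleModule ↥(Algebra.adjoin (AlgebraicClosure ℚ_[ℓ]) S) (AlgebraicClosure ℚ_[ℓ] ⊗[ℚ_[ℓ]] C.etaleH1 ℓ K) := by
  haveI := T.isSemisimpleRing_adjoin_baseChange_of_isSemisimpleRing_heckeImage ℓ K hD hH S hS
  infer_instance

/-! ## §3 A positive anti-involution stabilising the Hecke image ([MumfordAV1970] §21 Thm. 1) -/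

/-- **A positive anti-involution of `End⁰(A_K)` stabilising `heckeImage K` makes it a semisimple ring** — [MumfordAV1970] §21 Thm. 1 for the
`′`-stable subalgebra (★ `IsPositiveAntiInvolution.isSemisimpleRing_subalgebra`; `End⁰(A_K)` is finite-dimensional, §19 Cor. 2).  Typical `τ`: the
Rosati involution of a polarisation of `A_K` ([Lange2023AbelianVarietiesComplex] Thm. 2.4.9) under which every Hecke correspondence `[KgK]` has a Hecke
correspondence as adjoint. [cite: MumfordAV1970, §21 Thm. 1] [cite: Lange2023AbelianVarietiesComplex, §2.4.1 Thm. 2.4.9 and §2.6.2]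
[cite: Liu2021, p. 133 (before (D.3), FJcycle.tex l. 5463)] -/
theorem isSemisimpleRing_heckeImage_of_isPositiveAntiInvolution (hD : T.IsogenyDescent)
    {τ : (C.A K).endAlgebra →ₗ[ℚ] (C.A K).endAlgebra}
    (hτ : Literature.RingTheory.CentralSimple.IsPositiveAntiInvolution (C.A K).endAlgebra τ)
    (hτH : ∀ x ∈ T.heckeImage hD K, τ x ∈ T.heckeImage hD K) :
    IsSemisimpleRing ↥(T.heckeImage hD K) := by
  haveI : Module.Finite ℚ (C.A K).endAlgebra := endAlgebra.instModuleFinite (C.A K)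
  exact hτ.isSemisimpleRing_subalgebra (T.heckeImage hD K) hτH

/-- `H¹_ét(A_K)` is a semisimple Hecke module, granted a positive anti-involution of `End⁰(A_K)` stabilising `heckeImage K` (§3 + §2).
[cite: MumfordAV1970, §21 Thm. 1] [cite: Liu2021, p. 133 (D.3)] -/
theorem isSemisimpleModule_etaleH1_of_isPositiveAntiInvolution (hD : T.IsogenyDescent)
    {τ : (C.A K).endAlgebra →ₗ[ℚ] (C.A K).endAlgebra}
    (hτ : Literature.RingTheory.CentralSimple.IsPositiveAntiInvolution (C.A K).endAlgebra τ)
    (hτH : ∀ x ∈ T.heckeImage hD K, τ x ∈ T.heckeImage hD K) :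
    IsSemisimpleModule
      ↥(Algebra.adjoin ℚ_[ℓ] (Set.range fun g : C.G => (rationalTateAction (C.A K) ℓ (T.heckeEnd hD K g)).dualMap))
      (C.etaleH1 ℓ K) :=
  T.isSemisimpleModule_etaleH1_of_isSemisimpleRing_heckeImage ℓ K hD (T.isSemisimpleRing_heckeImage_of_isPositiveAntiInvolution K hD hτ hτH)

/-- `ℚ̄_ℓ ⊗` form: `𝒜` is a semisimple ring, granted a positive anti-involution of `End⁰(A_K)` stabilising `heckeImage K`.
[cite: MumfordAV1970, §21 Thm. 1] [cite: Liu2021, p. 133 (D.3)] -/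
theorem isSemisimpleRing_adjoin_baseChange_of_isPositiveAntiInvolution (hD : T.IsogenyDescent)
    {τ : (C.A K).endAlgebra →ₗ[ℚ] (C.A K).endAlgebra}
    (hτ : Literature.RingTheory.CentralSimple.IsPositiveAntiInvolution (C.A K).endAlgebra τ)
    (hτH : ∀ x ∈ T.heckeImage hD K, τ x ∈ T.heckeImage hD K)
    (S : Set (Module.End (AlgebraicClosure ℚ_[ℓ]) (AlgebraicClosure ℚ_[ℓ] ⊗[ℚ_[ℓ]] C.etaleH1 ℓ K)))
    (hS : S = Set.range fun g : C.G => ((rationalTateAction (C.A K) ℓ (T.heckeEnd hD K g)).dualMap).baseChange (AlgebraicClosure ℚ_[ℓ])) :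
    IsSemisimpleRing ↥(Algebra.adjoin (AlgebraicClosure ℚ_[ℓ]) S) :=
  T.isSemisimpleRing_adjoin_baseChange_of_isSemisimpleRing_heckeImage ℓ K hD
    (T.isSemisimpleRing_heckeImage_of_isPositiveAntiInvolution K hD hτ hτH) S hS

/-- `ℚ̄_ℓ ⊗` form: `ℚ̄_ℓ ⊗ H¹_ét(A_K)` is a semisimple `𝒜`-module, granted a positive anti-involution of `End⁰(A_K)` stabilising `heckeImage K`.
[cite: MumfordAV1970, §21 Thm. 1] [cite: Liu2021, p. 133 (D.3)] -/
theorem isSemisimpleModule_baseChange_etaleH1_of_isPositiveAntiInvolution (hD : T.IsogenyDescent)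
    {τ : (C.A K).endAlgebra →ₗ[ℚ] (C.A K).endAlgebra}
    (hτ : Literature.RingTheory.CentralSimple.IsPositiveAntiInvolution (C.A K).endAlgebra τ)
    (hτH : ∀ x ∈ T.heckeImage hD K, τ x ∈ T.heckeImage hD K)
    (S : Set (Module.End (AlgebraicClosure ℚ_[ℓ]) (AlgebraicClosure ℚ_[ℓ] ⊗[ℚ_[ℓ]] C.etaleH1 ℓ K)))
    (hS : S = Set.range fun g : C.G => ((rationalTateAction (C.A K) ℓ (T.heckeEnd hD K g)).dualMap).baseChange (AlgebraicClosure ℚ_[ℓ])) :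
    IsSemisimpleModule ↥(Algebra.adjoin (AlgebraicClosure ℚ_[ℓ]) S) (AlgebraicClosure ℚ_[ℓ] ⊗[ℚ_[ℓ]] C.etaleH1 ℓ K) :=
  T.isSemisimpleModule_baseChange_etaleH1_of_isSemisimpleRing_heckeImage ℓ K hD
    (T.isSemisimpleRing_heckeImage_of_isPositiveAntiInvolution K hD hτ hτH) S hS

/-- **Socket form** (the cell's `SocketRos` text, one existential per level): if EVERY small level carries a positive anti-involution of `End⁰(A_K)`
stabilising `heckeImage K`, then at every small level `heckeImage K` is a semisimple ring and `H¹_ét(A_K)` is a semisimple Hecke module.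
[cite: MumfordAV1970, §21 Thm. 1] [cite: Liu2021, p. 133 (D.3)] -/
theorem isSemisimpleRing_heckeImage_of_forall_exists_isPositiveAntiInvolution (hD : T.IsogenyDescent)
    (h : ∀ K : C5.SmallLevel C.S.K₀, ∃ τ : (C.A K).endAlgebra →ₗ[ℚ] (C.A K).endAlgebra,
      Literature.RingTheory.CentralSimple.IsPositiveAntiInvolution (C.A K).endAlgebra τ ∧ ∀ x ∈ T.heckeImage hD K, τ x ∈ T.heckeImage hD K)
    (K : C5.SmallLevel C.S.K₀) :
    IsSemisimpleRing ↥(T.heckeImage hD K) ∧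
      IsSemisimpleModule
        ↥(Algebra.adjoin ℚ_[ℓ] (Set.range fun g : C.G => (rationalTateAction (C.A K) ℓ (T.heckeEnd hD K g)).dualMap))
        (C.etaleH1 ℓ K) := by
  obtain ⟨τ, hτ, hτH⟩ := h K
  exact ⟨T.isSemisimpleRing_heckeImage_of_isPositiveAntiInvolution K hD hτ hτH,
    T.isSemisimpleModule_etaleH1_of_isPositiveAntiInvolution ℓ K hD hτ hτH⟩

end Sec42Data.HeckeTranslates

end Literature.NumberTheory.Automorphic.Liu2021.AppendixC

end
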